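import Mathlib
import Summits.Ventures.HodgeRepro.Tier4.Common.SettingOfData
import Summits.Ventures.HodgeRepro.Tier4.Line1.RtfGeometric
import Summits.Ventures.HodgeRepro.Tier4.Line4.GeometricSide
import Summits.Ventures.HodgeRepro.Tier4.Line4.OrbitalUnfold

/-!
# Tier4/Line4/OrbitalOfOrbitalc — C-L4-CONV-Z: the setting's orbital term of a rational double coset is the sum of the
folded orbital integrals over the orbit `T(k) γ₀ T′(k)`

Blind re-derivation cell `pub-hodge-repro`, Tier 4 «PROVE THE STEP» (README §9–§10), LINE L4, cut C-L4-CONV-Z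
(t4-plan-4 g3 S14360: statements typed by the planner, HOME proofs/t4-plan-4/work/OrbitalOfOrbitalc-STATEMENTS.lean
5384d5b893b25d0c, taken verbatim); seat t4-L2-p3 (gen 3).  `S := Setting.ofAdelicData W R μ DG fdG compG compT compT'`
(Common/SettingOfData): `S.Gk = G(k)`, `S.T = T(𝔸)`, `S.T′ = T′(𝔸)`, `S.DT = R.DT`, `S.μT = R.μT`, and the setting's
rational double cosets `S.orbitOf γ = DoubleCoset.mk S.Tk S.T′k γ`.

* `orbitOf_eq_iff_mem_range` (1): `S.orbitOf γ = S.orbitOf γ₀ ⟺ γ ∈ Set.range (orbitMap W γ₀)` — Mathlib's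
  `DoubleCoset.eq` (`mk H K a = mk H K b ↔ ∃ h ∈ H, ∃ k ∈ K, b = h * a * k`) against OrbitalUnfold's
  `orbitMap W γ₀ (δ, δ′) = δ⁻¹ γ₀ δ′` (`h ↦ δ := h`, `k ↦ δ′ := k⁻¹`); the two `subgroupOf` presentations of `T(k)` are
  the same elements of `G(𝔸)`;
* `orbital_eq_tsum_orbitalc` (2): `S.orbital χ χ′ (S.orbitOf γ₀) F = ∑′_{γ ∈ T(k) γ₀ T′(k)} orbitalc γ F` — unfold
  `Setting.orbital` (`∫_{D_T} ∫_{D_{T′}} partialKernel (orbitOf γ₀) F t t′ · χ t · conj χ′(t′)`, the partial kernel the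
  sum over the fibre `{γ // orbitOf γ = orbitOf γ₀}`) and `orbitalc` (`orbitalc_eq_integral`), reindex the fibre by (1)
  (`Equiv.subtypeEquivRight`), pull `χ t · conj χ′(t′)` into the sum, and exchange `∑′` with `∫_{D_T}` and `∫_{D_{T′}}`
  (`integral_tsum_of_summable_integral_norm` twice) under the displayed (A1)–(A4) of OrbitalUnfold restricted to the
  orbit;
* `orbital_ne_zero_of_tsum_ne_zero` (3): the consumer's shape for v0.28's `horb` — non-vanishing of the orbit sum gives
  non-vanishing of the orbital term (= (2) ▸ `hne`).  With L2-p3's `tsum_orbit_eq_setIntegral_innerFull_of_regular`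
  (Line4/OrbitalUnfoldCentral) the orbit sum is `∫_{D_Z} χ(t) · innerFull F γ₀ t` — not composed here.

Nothing here asserts any hypothesis; nothing is about the wall's truth.  HC_CM is NOT proved by anyone in this
repository.
-/

set_option autoImplicit false
noncomputable section
namespace Summit.Ventures.HodgeRepro.Tier4.Line4
open Summit.Ventures.HodgeRepro.Tier4.Common Summit.Ventures.HodgeRepro.Tier4.Line1 MeasureTheory NumberField
open scoped ComplexConjugate

variable {k : Type} [Field k] [NumberField k] (W : PlaneData k) [MeasurableSpace (GA W)] [BorelSpace (GA W)]
  (R : RTFData W) (μ : Measure (GA W)) [μ.IsHaarMeasure] [R.μT.IsHaarMeasure] [R.μT'.IsHaarMeasure]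
  (DG : Set (GA W)) (fdG : IsFundamentalDomain (rationalPoints W) DG μ) (compG : IsCompact (closure DG))
  (compT : IsCompact (closure R.DT)) (compT' : IsCompact (closure R.DT'))

/-- **The rational double coset of `γ₀` is the range of `orbitMap`** (cut C-L4-CONV-Z (1)): `orbitOf γ = orbitOf γ₀` in
the setting ⟺ `γ = δ⁻¹ γ₀ δ′` for rational `δ ∈ T(k)`, `δ′ ∈ T′(k)` (`DoubleCoset.eq` + the `subgroupOf` conventions). -/
theorem orbitOf_eq_iff_mem_range (γ γ₀ : rationalPoints W) :
    (Setting.ofAdelicData W R μ DG fdG compG compT compT').orbitOf γ =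
        (Setting.ofAdelicData W R μ DG fdG compG compT compT').orbitOf γ₀ ↔
      γ ∈ Set.range (orbitMap W γ₀) := by
  rw [RTF.Setting.orbitOf, RTF.Setting.orbitOf, DoubleCoset.eq]
  constructor
  · rintro ⟨h, hh, k, hk, hγ₀⟩
    have hhT : (h : GA W) ∈ torusT W := Subgroup.mem_subgroupOf.1 hh
    have hkT : (k : GA W) ∈ torusT' W := Subgroup.mem_subgroupOf.1 hk
    refine ⟨(⟨⟨(h : GA W), hhT⟩, h.2⟩, (⟨⟨(k : GA W), hkT⟩, k.2⟩ : rationalOf W (torusT' W))⁻¹), ?_⟩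
    apply Subtype.ext
    have hγ₀' : (γ₀ : GA W) = (h : GA W) * (γ : GA W) * (k : GA W) := by
      rw [hγ₀, Subgroup.coe_mul, Subgroup.coe_mul]
    show (h : GA W)⁻¹ * (γ₀ : GA W) * (k : GA W)⁻¹ = (γ : GA W)
    rw [hγ₀', mul_assoc (h : GA W) (γ : GA W) (k : GA W), inv_mul_cancel_left, mul_inv_cancel_right]
  · rintro ⟨⟨δ, δ'⟩, hδ⟩
    refine ⟨⟨((δ : torusT W) : GA W), δ.2⟩, Subgroup.mem_subgroupOf.2 (δ : torusT W).2,
      (⟨((δ' : torusT' W) : GA W), δ'.2⟩ : rationalPoints W)⁻¹,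
      (Subgroup.inv_mem _ (Subgroup.mem_subgroupOf.2 (δ' : torusT' W).2)), ?_⟩
    apply Subtype.ext
    have hδ' : ((δ : torusT W) : GA W)⁻¹ * (γ₀ : GA W) * ((δ' : torusT' W) : GA W) = (γ : GA W) := by
      have := congrArg (fun x : rationalPoints W => (x : GA W)) hδ
      simpa only [orbitMap_val] using this
    show (γ₀ : GA W) = ((δ : torusT W) : GA W) * (γ : GA W) * ((δ' : torusT' W) : GA W)⁻¹
    rw [← hδ', ← mul_assoc ((δ : torusT W) : GA W) (((δ : torusT W) : GA W)⁻¹ * (γ₀ : GA W)),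
      mul_inv_cancel_left, mul_inv_cancel_right]

/-- **The orbital term of the setting is the sum of the unfolded orbital integrals over the double coset**
(cut C-L4-CONV-Z (2)): `orbital χ χ′ (orbitOf γ₀) F = ∑′_{γ ∈ T(k) γ₀ T′(k)} O_γ(F)` — the two exchanges of `∑′` with
`∫_{D_T}` and `∫_{D_{T′}}` under the displayed integrability / normal summability (OrbitalUnfold's (A1)–(A4) restricted to
the orbit) and the reindexing (1). -/
theorem orbital_eq_tsum_orbitalc (F : GA W → ℂ) (γ₀ : rationalPoints W)
    (hA1 : ∀ (γ : rationalPoints W) (t : torusT W),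
      Integrable (innerFn W R F (γ : GA W) t) (R.μT'.restrict R.DT'))
    (hA2 : ∀ t : torusT W, Summable (fun γ : Set.range (orbitMap W γ₀) =>
      ∫ t' in R.DT', ‖innerFn W R F ((γ : rationalPoints W) : GA W) t t'‖ ∂(R.μT')))
    (hA3 : ∀ γ : rationalPoints W,
      Integrable (fun t : torusT W => R.chi t * innerInt W R F (γ : GA W) t) (R.μT.restrict R.DT))
    (hA4 : Summable (fun γ : Set.range (orbitMap W γ₀) =>
      ∫ t in R.DT, ‖R.chi t * innerInt W R F ((γ : rationalPoints W) : GA W) t‖ ∂(R.μT))) :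
    (Setting.ofAdelicData W R μ DG fdG compG compT compT').orbital R.chi R.chi'
        ((Setting.ofAdelicData W R μ DG fdG compG compT compT').orbitOf γ₀) F =
      ∑' γ : Set.range (orbitMap W γ₀), R.orbitalc ((γ : rationalPoints W) : GA W) F := by
  haveI : Countable (rationalPoints W) := rationalPoints_countable W
  set S := Setting.ofAdelicData W R μ DG fdG compG compT compT' with hS
  -- the fibre of the double coset, reindexed by the orbit
  have hfib : ∀ (t : torusT W) (t' : torusT' W), S.partialKernel (S.orbitOf γ₀) F (t : GA W) (t' : GA W) =
      ∑' γ : Set.range (orbitMap W γ₀),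
        F ((t : GA W)⁻¹ * ((γ : rationalPoints W) : GA W) * (t' : GA W)) := by
    intro t t'
    unfold RTF.Setting.partialKernel
    exact (Equiv.subtypeEquivRight
      (fun γ => orbitOf_eq_iff_mem_range W R μ DG fdG compG compT compT' γ γ₀)).tsum_eq
      (fun γ : Set.range (orbitMap W γ₀) => F ((t : GA W)⁻¹ * ((γ : rationalPoints W) : GA W) * (t' : GA W)))
  symm
  calc (∑' γ : Set.range (orbitMap W γ₀), R.orbitalc ((γ : rationalPoints W) : GA W) F)
      = ∑' γ : Set.range (orbitMap W γ₀),
          ∫ t in R.DT, R.chi t * innerInt W R F ((γ : rationalPoints W) : GA W) t ∂(R.μT) :=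
        tsum_congr fun γ => orbitalc_eq_integral W R F _ (hA1 _) (hA3 _)
    _ = ∫ t in R.DT, ∑' γ : Set.range (orbitMap W γ₀),
          R.chi t * innerInt W R F ((γ : rationalPoints W) : GA W) t ∂(R.μT) :=
        integral_tsum_of_summable_integral_norm (fun γ => hA3 _) hA4
    _ = ∫ t in R.DT, R.chi t * ∫ t' in R.DT', R.chi'conj t' * ∑' γ : Set.range (orbitMap W γ₀),
          F ((t : GA W)⁻¹ * ((γ : rationalPoints W) : GA W) * (t' : GA W)) ∂(R.μT') ∂(R.μT) := by
        refine integral_congr_ae (Filter.Eventually.of_forall fun t => ?_)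
        dsimp only
        rw [tsum_mul_left]
        congr 1
        unfold innerInt
        rw [integral_tsum_of_summable_integral_norm (fun γ => hA1 _ t) (hA2 t)]
        refine integral_congr_ae (Filter.Eventually.of_forall fun t' => ?_)
        dsimp only
        unfold innerFn
        rw [tsum_mul_left]
    _ = S.orbital R.chi R.chi' (S.orbitOf γ₀) F := by
        show _ = ∫ t in R.DT, ∫ t' in R.DT',
          S.partialKernel (S.orbitOf γ₀) F (t : GA W) (t' : GA W) * R.chi t * conj (R.chi' t') ∂(R.μT') ∂(R.μT)
        refine integral_congr_ae (Filter.Eventually.of_forall fun t => ?_)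
        dsimp only
        rw [← integral_const_mul]
        refine integral_congr_ae (Filter.Eventually.of_forall fun t' => ?_)
        dsimp only
        rw [hfib t t']
        unfold RTFData.chi'conj
        ring

/-- **`horb` from the unfolded `Z(k)`-domain integral** (cut C-L4-CONV-Z (3), the consumer's shape): with (2) and
L2-p3's `tsum_orbit_eq_setIntegral_innerFull_of_regular` the orbital term is `∫_{D_Z} χ(t) · innerFull F γ₀ t`, so its
non-vanishing is the non-vanishing of that integral. Stated here only through (2): non-vanishing of the orbit sum. -/
theorem orbital_ne_zero_of_tsum_ne_zero (F : GA W → ℂ) (γ₀ : rationalPoints W)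
    (hA1 : ∀ (γ : rationalPoints W) (t : torusT W),
      Integrable (innerFn W R F (γ : GA W) t) (R.μT'.restrict R.DT'))
    (hA2 : ∀ t : torusT W, Summable (fun γ : Set.range (orbitMap W γ₀) =>
      ∫ t' in R.DT', ‖innerFn W R F ((γ : rationalPoints W) : GA W) t t'‖ ∂(R.μT')))
    (hA3 : ∀ γ : rationalPoints W,
      Integrable (fun t : torusT W => R.chi t * innerInt W R F (γ : GA W) t) (R.μT.restrict R.DT))
    (hA4 : Summable (fun γ : Set.range (orbitMap W γ₀) =>
      ∫ t in R.DT, ‖R.chi t * innerInt W R F ((γ : rationalPoints W) : GA W) t‖ ∂(R.μT)))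
    (hne : (∑' γ : Set.range (orbitMap W γ₀), R.orbitalc ((γ : rationalPoints W) : GA W) F) ≠ 0) :
    (Setting.ofAdelicData W R μ DG fdG compG compT compT').orbital R.chi R.chi'
      ((Setting.ofAdelicData W R μ DG fdG compG compT compT').orbitOf γ₀) F ≠ 0 := by
  rw [orbital_eq_tsum_orbitalc W R μ DG fdG compG compT compT' F γ₀ hA1 hA2 hA3 hA4]
  exact hne

end Summit.Ventures.HodgeRepro.Tier4.Line4

end
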